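import Literature.AlgebraicGeometry.ShimuraVarieties.UnitaryBallDiscontinuity
import Literature.AlgebraicTopology.SingularHomology.FiniteCoverTransfer
import Literature.AlgebraicGeometry.Motives.AlgPointsProperProofs
import Literature.AlgebraicGeometry.Motives.VarietiesProperProofs
import Literature.NumberTheory.Transcendental.AnalytificationSeparatedProofs
import HarnessLib

/-!
# Level maps between torsion-free unitary ball quotients are finite coverings

For two unitary ball-quotient data `D₁ : UnitaryBallUniformisationDatum 2 X₁`, `D₂ : UnitaryBallUniformisationDatum 2 X₂`
with the SAME hermitian space (`D₁.Hℂ = D₂.Hℂ`, so the same negative cone and the same ball charts) and a map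
`f : X₁(ℂ) → X₂(ℂ)` INTERTWINING THE TWO UNIFORMIZATIONS (`f (unif₁ v) = unif₂ v` on the cone — this is the
shape of a level map `Γ₁ \ 𝔹 → Γ₂ \ 𝔹` for `Γ₁ ≤ Γ₂`), we PROVE:

* `isOpenMap_ballUnifMap`, `isLocalHomeomorph_ballUnifMap` — the uniformization `𝔹² → X(ℂ)` of ONE datum is an
  open map and a local homeomorphism (open: saturation through the cone chart + the field `isOpenMap_unif`;
  locally injective: the tree's `exists_isOpen_injOn_ballUnifMap`, i.e. proper discontinuity + freeness,
  Borel 1969 Prop. 7.13);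
* `isLocalHomeomorph_of_unif_comp` — `f` is a local homeomorphism (`f ∘ unif₁ = unif₂` with both
  uniformizations local homeomorphisms and `unif₁` onto; Mathlib `IsLocalHomeomorphOn.of_comp_right`);
* `isCoveringMap_of_unif_comp` — `f` is a covering map: a local homeomorphism from the compact Hausdorff
  space `X₁(ℂ)` (`X₁` smooth projective: the tree's `compactSpace_algPoints_of_isProper_holds`,
  `ComplexPoints.t2Space_of_isSeparated`) to the Hausdorff space `X₂(ℂ)` is a covering map
  (Mathlib `isLocalHomeomorph_iff_isCoveringMap`);
* `surjective_of_unif_comp`, `finite_preimage_of_unif_comp` — `f` is onto with finite fibres;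
* `IsFiniteCover.sheets`, `sheets_pos` — the number of sheets of a finite covering (least fibre cardinality;
  Hatcher 2002 §1.3 p. 56), positive over a non-empty base;
* `isFiniteCover_of_unif_comp` — hence `f` is a finite covering in the sense of the tree's
  `IsFiniteCover` (`Literature/AlgebraicTopology/SingularHomology/FiniteCoverTransfer.lean`),
  so the normalised transfer `τ^*` with `τ^* ∘ f^* = id` on `Hⁿ(X₂(ℂ); R)` (`R` a `ℚ`-algebra) is available
  for it (`IsFiniteCover.transferMap_map`, Hatcher 2002 §3.G Prop. 3G.1).

Mathematical source: for torsion-free lattices `Γ₁ ≤ Γ₂ < U(2,1)` the map `Γ₁\𝔹² → Γ₂\𝔹²` is a finite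
(unramified) covering of compact complex manifolds — Bergeron–Millson–Moeglin 2016, Introduction §1.1 and
Part 2 §1.3 (the tower of ball quotients `S(Γ)`), with proper discontinuity from Borel 1969, Prop. 7.13, and
the transfer from Hatcher 2002, §3.G.  Everything here is a THEOREM over the tree's definitions; no named
fact is introduced.

Written under the LEAN-IN-TREE rule for the pub-hodgecm formalisation cell (model-construction sub-cell,
seat mc-axioms-1 gen 7, MODEL-DAG node N-i1: the Betti push-forward along a change of level). Nothing in
this file is a claim of the manuscripts adjudicated by that cell.
-/

set_option autoImplicit false

noncomputable section

open Matrix Complex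
open Literature.Geometry.ComplexHyperbolic
open Literature.Geometry.ComplexHyperbolic.BallModel
open Literature.AlgebraicTopology.SingularHomology

namespace Literature.AlgebraicTopology.SingularHomology.IsFiniteCover

universe u

variable {E B : Type u} [TopologicalSpace E] [TopologicalSpace B] {proj : C(E, B)} (c : IsFiniteCover proj)

/-- **The number of sheets** of a finite covering: the least cardinality of a fibre (the fibres are finite and
non-empty; "the number of sheets … is the cardinality of `p⁻¹(x)` … locally constant, so it is constant if `X` is
connected"). [cite: HatcherAT2002, §1.3 p. 56] -/
def sheets (_c : IsFiniteCover proj) : ℕ := ⨅ b, (proj ⁻¹' {b}).ncard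

include c in
/-- Every fibre of a finite covering is a non-empty finite set. [cite: HatcherAT2002, §1.3 p. 56] -/
theorem ncard_fibre_pos (b : B) : 0 < (proj ⁻¹' {b}).ncard :=
  (Set.ncard_pos (c.finite_fibre b)).2 (c.surjective b)

/-- The number of sheets bounds every fibre cardinality from below. [cite: HatcherAT2002, §1.3 p. 56] -/
theorem sheets_le (b : B) : c.sheets ≤ (proj ⁻¹' {b}).ncard := ciInf_le' _ b

/-- Over a non-empty base a finite covering has a positive number of sheets. [cite: HatcherAT2002, §1.3 p. 56] -/
theorem sheets_pos [Nonempty B] : 0 < c.sheets :=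
  lt_of_lt_of_le Nat.one_pos (le_ciInf fun b ↦ c.ncard_fibre_pos b)

end Literature.AlgebraicTopology.SingularHomology.IsFiniteCover

namespace Literature.AlgebraicGeometry.ShimuraVarieties

namespace UnitaryBallUniformisationDatum

open Literature.AlgebraicGeometry.Motives (SchemeOver ComplexPoints IsSmoothProjective)
open Literature.AlgebraicGeometry.Motives

variable {X₁ X₂ : SchemeOver ℂ} (D₁ : UnitaryBallUniformisationDatum 2 X₁) (D₂ : UnitaryBallUniformisationDatum 2 X₂)


/-! ### One datum: the uniformization on the ball is an open local homeomorphism -/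

/-- The image of a set under `ballUnifMap` is the image under `unif|cone` of its preimage under the cone
chart (the chart is onto with section `coneLift`, and `unif` is constant on the chart's fibres).
[cite: BergeronMillsonMoeglin2016Balls, Introduction §1.1] -/
theorem image_ballUnifMap (𝔣 : D₂.SylvesterFrame) (O : Set Ball) :
    D₂.ballUnifMap 𝔣 '' O = D₂.cone.restrict D₂.unif '' (D₂.coneChart 𝔣 ⁻¹' O) := by
  ext P
  constructor
  · rintro ⟨z, hz, rfl⟩
    refine ⟨D₂.coneLift 𝔣 z, ?_, rfl⟩
    rw [Set.mem_preimage, D₂.coneChart_coneLift]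
    exact hz
  · rintro ⟨v, hv, rfl⟩
    exact ⟨D₂.coneChart 𝔣 v, hv, (D₂.unif_eq_ballUnifMap_coneChart 𝔣 v).symm⟩

/-- **The uniformization `𝔹² → X(ℂ)` is an open map** (field `isOpenMap_unif` of the datum, transported
through the continuous cone chart). [cite: BergeronMillsonMoeglin2016Balls, Introduction §1.1] -/
theorem isOpenMap_ballUnifMap (𝔣 : D₂.SylvesterFrame) : IsOpenMap (D₂.ballUnifMap 𝔣) := by
  intro O hO
  rw [D₂.image_ballUnifMap 𝔣 O]
  exact D₂.isOpenMap_unif _ (hO.preimage (D₂.continuous_coneChart 𝔣))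

/-- **The uniformization `𝔹² → X(ℂ)` is a quotient map.** [cite: BergeronMillsonMoeglin2016Balls, Introduction §1.1] -/
theorem isQuotientMap_ballUnifMap (𝔣 : D₂.SylvesterFrame) :
    Topology.IsQuotientMap (D₂.ballUnifMap 𝔣) :=
  (D₂.isOpenMap_ballUnifMap 𝔣).isQuotientMap (D₂.continuous_ballUnifMap 𝔣)
    (D₂.ballUnifMap_surjective 𝔣)

/-- **The uniformization `𝔹² → Γ\𝔹² = X(ℂ)` of a torsion-free ball quotient is a local homeomorphism**:
continuous, open, and injective near every point (`exists_isOpen_injOn_ballUnifMap`: `Γ` acts freely and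
properly discontinuously). [cite: Borel1969, Prop. 7.13] [cite: BergeronMillsonMoeglin2016Balls, Introduction §1.1] -/
theorem isLocalHomeomorph_ballUnifMap (𝔣 : D₂.SylvesterFrame) :
    IsLocalHomeomorph (D₂.ballUnifMap 𝔣) := by
  refine isLocalHomeomorph_iff_isOpenEmbedding_restrict.2 fun z ↦ ?_
  obtain ⟨U, hUo, hzU, hinj⟩ := D₂.exists_isOpen_injOn_ballUnifMap 𝔣 z
  exact ⟨U, hUo.mem_nhds hzU, .of_continuous_injective_isOpenMap
    ((D₂.continuous_ballUnifMap 𝔣).comp continuous_subtype_val)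
    (Set.injOn_iff_injective.1 hinj) ((D₂.isOpenMap_ballUnifMap 𝔣).restrict hUo)⟩

/-- `X(ℂ)` is non-empty for a ball-quotient datum (it is the image of the ball). [folklore] -/
theorem nonempty_complexPoints (D : UnitaryBallUniformisationDatum 2 X₂) : Nonempty (ComplexPoints X₂) :=
  let ⟨𝔣⟩ := D.nonempty_sylvesterFrame
  ⟨D.ballUnifMap 𝔣 x₀⟩

/-- `X(ℂ)` is compact for a ball-quotient datum (`X` is smooth projective). [cite: SerreGAGA1956, §2 Prop. 6] -/
theorem compactSpace_complexPoints (D : UnitaryBallUniformisationDatum 2 X₂) : CompactSpace (ComplexPoints X₂) := by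
  haveI := IsSmoothProjective.isProper_holds D.isSmoothProjective
  exact compactSpace_algPoints_of_isProper_holds X₂ ℂ

/-- `X(ℂ)` is Hausdorff for a ball-quotient datum (`X` is separated). [cite: SGA1, Exp. XII Prop. 3.1 (viii)] -/
theorem t2Space_complexPoints (D : UnitaryBallUniformisationDatum 2 X₂) : T2Space (ComplexPoints X₂) := by
  haveI := IsSmoothProjective.isProper_holds D.isSmoothProjective
  exact ComplexPoints.t2Space_of_isSeparated X₂

/-! ### Two data with the same hermitian space -/

namespace SylvesterFrame

variable {D₁ D₂}

/-- A Sylvester frame for `D₂` is one for `D₁` when `D₁.Hℂ = D₂.Hℂ` (same frame matrix). [folklore] -/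
def transport (hH : D₁.Hℂ = D₂.Hℂ) (𝔣 : D₂.SylvesterFrame) : D₁.SylvesterFrame :=
  ⟨𝔣.T, by rw [hH]; exact 𝔣.conjTranspose_mul_mul⟩

/-- The transported frame has the same frame matrix. [folklore] -/
@[simp] theorem transport_T (hH : D₁.Hℂ = D₂.Hℂ) (𝔣 : D₂.SylvesterFrame) :
    (transport hH 𝔣).T = 𝔣.T := rfl

/-- The transported frame has the same cone section. [folklore] -/
theorem coe_coneLift_transport (hH : D₁.Hℂ = D₂.Hℂ) (𝔣 : D₂.SylvesterFrame) (z : Ball) :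
    ((D₁.coneLift (transport hH 𝔣) z : D₁.cone) : Fin 3 → ℂ) = (D₂.coneLift 𝔣 z : Fin 3 → ℂ) := rfl

end SylvesterFrame

variable {D₁ D₂}

/-- `f ∘ unif₁ = unif₂` on the cone gives `f ∘ ballUnifMap₁ = ballUnifMap₂` in a common frame. [folklore] -/
theorem apply_ballUnifMap_transport (hH : D₁.Hℂ = D₂.Hℂ) (𝔣 : D₂.SylvesterFrame)
    {f : ComplexPoints X₁ → ComplexPoints X₂} (hf : ∀ v ∈ D₁.cone, f (D₁.unif v) = D₂.unif v) (z : Ball) :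
    f (D₁.ballUnifMap (SylvesterFrame.transport hH 𝔣) z) = D₂.ballUnifMap 𝔣 z := by
  rw [ballUnifMap_apply, ballUnifMap_apply, hf _ (D₁.coneLift _ z).2]
  rfl

/-- **A map intertwining the uniformizations of two ball quotients with the same hermitian space is a local
homeomorphism** (both uniformizations are local homeomorphisms and the first is onto).
[cite: BergeronMillsonMoeglin2016Balls, Introduction §1.1] -/
theorem isLocalHomeomorph_of_unif_comp (hH : D₁.Hℂ = D₂.Hℂ)
    {f : ComplexPoints X₁ → ComplexPoints X₂} (hf : ∀ v ∈ D₁.cone, f (D₁.unif v) = D₂.unif v) :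
    IsLocalHomeomorph f := by
  obtain ⟨𝔣⟩ := D₂.nonempty_sylvesterFrame
  have hcomp : f ∘ D₁.ballUnifMap (SylvesterFrame.transport hH 𝔣) = D₂.ballUnifMap 𝔣 :=
    funext (apply_ballUnifMap_transport hH 𝔣 hf)
  have h₂ : IsLocalHomeomorphOn (f ∘ D₁.ballUnifMap (SylvesterFrame.transport hH 𝔣)) Set.univ := by
    rw [hcomp]
    exact (D₂.isLocalHomeomorph_ballUnifMap 𝔣).isLocalHomeomorphOn
  have h := h₂.of_comp_right (D₁.isLocalHomeomorph_ballUnifMap _).isLocalHomeomorphOn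
  rw [Set.image_univ, (D₁.ballUnifMap_surjective _).range_eq] at h
  exact isLocalHomeomorph_iff_isLocalHomeomorphOn_univ.2 h

/-- **A map intertwining the uniformizations of two torsion-free ball quotients with the same hermitian space
is a covering map** (a local homeomorphism from a compact Hausdorff space to a Hausdorff space).
[cite: BergeronMillsonMoeglin2016Balls, Part 2 §1.3] -/
theorem isCoveringMap_of_unif_comp (hH : D₁.Hℂ = D₂.Hℂ)
    {f : ComplexPoints X₁ → ComplexPoints X₂} (hf : ∀ v ∈ D₁.cone, f (D₁.unif v) = D₂.unif v) :
    IsCoveringMap f := by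
  haveI := D₁.compactSpace_complexPoints
  haveI := D₁.t2Space_complexPoints
  haveI := D₂.t2Space_complexPoints
  exact isLocalHomeomorph_iff_isCoveringMap.1 (isLocalHomeomorph_of_unif_comp hH hf)

/-- Such a map is continuous. [folklore] -/
theorem continuous_of_unif_comp (hH : D₁.Hℂ = D₂.Hℂ)
    {f : ComplexPoints X₁ → ComplexPoints X₂} (hf : ∀ v ∈ D₁.cone, f (D₁.unif v) = D₂.unif v) :
    Continuous f :=
  (isLocalHomeomorph_of_unif_comp hH hf).continuous

/-- Such a map is onto. [cite: BergeronMillsonMoeglin2016Balls, Introduction §1.1] -/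
theorem surjective_of_unif_comp (hH : D₁.Hℂ = D₂.Hℂ)
    {f : ComplexPoints X₁ → ComplexPoints X₂} (hf : ∀ v ∈ D₁.cone, f (D₁.unif v) = D₂.unif v) :
    Function.Surjective f := by
  obtain ⟨𝔣⟩ := D₂.nonempty_sylvesterFrame
  intro P
  obtain ⟨z, rfl⟩ := D₂.ballUnifMap_surjective 𝔣 P
  exact ⟨_, apply_ballUnifMap_transport hH 𝔣 hf z⟩

/-- Such a map has finite fibres (discrete and closed in the compact space `X₁(ℂ)`).
[cite: BergeronMillsonMoeglin2016Balls, Part 2 §1.3] -/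
theorem finite_preimage_of_unif_comp (hH : D₁.Hℂ = D₂.Hℂ)
    {f : ComplexPoints X₁ → ComplexPoints X₂} (hf : ∀ v ∈ D₁.cone, f (D₁.unif v) = D₂.unif v)
    (P : ComplexPoints X₂) : (f ⁻¹' {P}).Finite := by
  haveI := D₁.compactSpace_complexPoints
  haveI := D₂.t2Space_complexPoints
  have hc := isCoveringMap_of_unif_comp hH hf
  haveI := (hc P).discreteTopology_fiber
  exact ((isClosed_singleton.preimage hc.continuous).isCompact).finite
    (isDiscrete_iff_discreteTopology.2 inferInstance)

/-- **A level map of torsion-free ball quotients is a finite covering** in the sense of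
`IsFiniteCover`, so the transfer `τ^*` with `τ^* ∘ f^* = id` in rational cohomology is
available for it (`IsFiniteCover.transferMap_map`).
[cite: BergeronMillsonMoeglin2016Balls, Part 2 §1.3] [cite: HatcherAT2002, §3.G Prop. 3G.1] -/
theorem isFiniteCover_of_unif_comp (hH : D₁.Hℂ = D₂.Hℂ)
    (f : C(ComplexPoints X₁, ComplexPoints X₂)) (hf : ∀ v ∈ D₁.cone, f (D₁.unif v) = D₂.unif v) :
    IsFiniteCover f where
  isCoveringMap := isCoveringMap_of_unif_comp hH hf
  surjective := surjective_of_unif_comp hH hf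
  finite_fibre := finite_preimage_of_unif_comp hH hf

/-- The covering `f` has a positive number of sheets. [cite: BergeronMillsonMoeglin2016Balls, Part 2 §1.3] -/
theorem sheets_pos_of_unif_comp (hH : D₁.Hℂ = D₂.Hℂ)
    (f : C(ComplexPoints X₁, ComplexPoints X₂)) (hf : ∀ v ∈ D₁.cone, f (D₁.unif v) = D₂.unif v) :
    0 < (isFiniteCover_of_unif_comp hH f hf).sheets :=
  haveI := D₂.nonempty_complexPoints
  (isFiniteCover_of_unif_comp hH f hf).sheets_pos

end UnitaryBallUniformisationDatum

end Literature.AlgebraicGeometry.ShimuraVarieties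

end
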